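import Mathlib
import HarnessLib
import Literature.Probability.MarkovChains.MixingTimeSubmultiplicative

/-!
# The counting lower bound `t_mix(ε) ≥ log(|X|(1 − ε))/log Δ` (Levin–Peres–Wilmer §7.1.1, eq. (7.2))

HONEST FRAMING: exact (Metropolis-corrected) sampling algorithms for lattice gauge theory; figures
of merit are autocorrelation/cost numbers at stated couplings and volumes; no continuum-physics claim.

Conventions of `TotalVariation.lean` / `BottleneckRatio.lean` / `MixingTimeSubmultiplicative.lean`:
finite `X`, ROW kernel `P : X → X → ℝ`, `kernelAt P t x y = Pᵗ(x,y)`, `tvDist` (half-`ℓ¹`),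
`worstTvDist P π t = d(t)`, `mixingTime P π ε = t_mix(ε)` (junk value `0` when no `t` has
`d(t) ≤ ε`; the statements about `t_mix` below assume some `t₀` has, as everywhere in the tree).
Source: D. A. Levin, Y. Peres (with E. L. Wilmer), *Markov Chains and Mixing Times*, 2nd ed., AMS
2017 [LevinPeres2017], §7.1.1 "Counting bound" (p. 88).  Everything is PROVED (finite sums; 0 named
facts, 0 definitions: the out-degree `d_out(x) = |{y : P(x,y) > 0}|` is written
`(univ.filter fun y => 0 < P x y).card`, the set `X_t^x` of states accessible from `x` in exactly
`t` steps is `univ.filter fun y => 0 < Pᵗ(x,y)`, and `Δ` is ANY bound `d_out(x) ≤ Δ` for all `x` —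
eq. (7.1) takes `Δ := max_x d_out(x)`).

* `kernelAt_zero_apply`, `kernelAt_succ_apply` — `P⁰(x,y) = 1{y = x}`,
  `P^{t+1}(x,y) = Σ_z Pᵗ(x,z)P(z,y)` [cite: LevinPeres2017, §1.1 (matrix powers `Pᵗ`)];
* `card_accessible_succ_le` — `|X_{t+1}^x| ≤ Δ·|X_t^x|`, and `card_accessible_le_pow` —
  **`|X_t^x| ≤ Δᵗ`** ("observe that `|X_t^x| ≤ Δᵗ`") [cite: LevinPeres2017, §7.1.1 (the sentence after
  eq. (7.1))];
* `one_le_outDegree` — a row-stochastic kernel has `d_out(x) ≥ 1`, so any `Δ` as above is `≥ 1`;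
* `LevinPeres2017_sec_7_1_1_tvDist` — for the UNIFORM `π`,
  **`‖Pᵗ(x,·) − π‖_TV ≥ Pᵗ(x, X_t^x) − π(X_t^x) ≥ 1 − Δᵗ/|X|`** [cite: LevinPeres2017, §7.1.1 (the
  display before eq. (7.2))];
* `LevinPeres2017_eq_7_2_lt` — "If `Δᵗ < (1 − ε)|X|`, then … `‖Pᵗ(x,·) − π‖_TV > ε`", hence `d(t) > ε`;
  `LevinPeres2017_eq_7_2_pow` — consequently `Δ^{t_mix(ε)} ≥ (1 − ε)|X|`; and **eq. (7.2)**
  `LevinPeres2017_eq_7_2`: for `ε < 1`, **`t_mix(ε) ≥ log(|X|(1 − ε))/log Δ`**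
  [cite: LevinPeres2017, §7.1.1 eq. (7.2)].  (For `Δ = 1` the printed right side is `·/0`, which is
  `0` in Lean, and the inequality is trivial; the book's standing "irreducible and aperiodic" is not
  needed for the inequality and is not assumed.)  NOT here: the reversible refinement (7.3).

Context (cell pub-lqcd, venture LatticeQCDFlow): the counting bound is the simplest "locality
barrier" for samplers built from local moves — a kernel that can reach at most `Δ` states per step
needs `≳ log|X|/log Δ` steps to approach the uniform law, whatever its acceptance rate; it is the
volume-scaling floor against which global (flow) proposals are measured.
-/

namespace Literature.Probability.MarkovChains

open Finset

variable {X : Type*} [Fintype X] [DecidableEq X]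

/-! ## The `t`-step kernel: recursion -/

/-- `P⁰(x,y) = 1{y = x}`. [cite: LevinPeres2017, §1.1 (`P⁰ = I`)] -/
theorem kernelAt_zero_apply (P : X → X → ℝ) (x y : X) :
    kernelAt P 0 x y = if y = x then 1 else 0 := by
  show lawAt P (Pi.single x 1) 0 y = _
  rw [lawAt_zero, Pi.single_apply]

/-- `P^{t+1}(x,y) = Σ_z Pᵗ(x,z) P(z,y)` (Chapman–Kolmogorov, last step).
[cite: LevinPeres2017, §1.1 (`μ_t = μ_{t−1}P`)] -/
theorem kernelAt_succ_apply (P : X → X → ℝ) (t : ℕ) (x y : X) :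
    kernelAt P (t + 1) x y = ∑ z, kernelAt P t x z * P z y := by
  show lawAt P (Pi.single x 1) (t + 1) y = _
  rw [lawAt_succ]
  rfl

/-! ## `|X_t^x| ≤ Δᵗ` -/

section Counting

variable {P : X → X → ℝ}

omit [DecidableEq X] in
/-- A row-stochastic kernel moves somewhere: `d_out(x) = |{y : P(x,y) > 0}| ≥ 1`.
[cite: LevinPeres2017, §7.1.1 eq. (7.1) (definition of `d_out`)] -/
theorem one_le_outDegree (hP : IsRowStochastic P) (x : X) :
    1 ≤ (univ.filter fun y => 0 < P x y).card := by
  rw [Nat.one_le_iff_ne_zero, Ne, card_eq_zero, filter_eq_empty_iff]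
  intro h
  have hzero : ∀ y, P x y = 0 := fun y => le_antisymm (not_lt.mp (h (mem_univ y))) (hP.1 x y)
  have hsum := hP.2 x
  simp [hzero] at hsum

/-- **One step grows the accessible set by at most the factor `Δ`**: `|X_{t+1}^x| ≤ Δ·|X_t^x|`,
since `X_{t+1}^x ⊆ ⋃_{z ∈ X_t^x} {y : P(z,y) > 0}`. [cite: LevinPeres2017, §7.1.1 ("observe that
`|X_t^x| ≤ Δᵗ`")] -/
theorem card_accessible_succ_le (hP : IsRowStochastic P) {Δ : ℕ}
    (hΔ : ∀ z, (univ.filter fun y => 0 < P z y).card ≤ Δ) (t : ℕ) (x : X) :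
    (univ.filter fun y => 0 < kernelAt P (t + 1) x y).card
      ≤ Δ * (univ.filter fun z => 0 < kernelAt P t x z).card := by
  set A := univ.filter fun z => 0 < kernelAt P t x z with hA
  have hk0 : ∀ z, 0 ≤ kernelAt P t x z := (kernelAt_isRowStochastic hP t).1 x
  have hsub : (univ.filter fun y => 0 < kernelAt P (t + 1) x y)
      ⊆ A.biUnion fun z => univ.filter fun y => 0 < P z y := by
    intro y hy
    rw [mem_filter, kernelAt_succ_apply] at hy
    obtain ⟨z, -, hz⟩ := (sum_pos_iff_of_nonneg fun z _ => mul_nonneg (hk0 z) (hP.1 z y)).mp hy.2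
    rcases pos_and_pos_or_neg_and_neg_of_mul_pos hz with ⟨hkz, hPz⟩ | ⟨hkz, -⟩
    · exact mem_biUnion.mpr ⟨z, by rw [hA, mem_filter]; exact ⟨mem_univ _, hkz⟩,
        mem_filter.mpr ⟨mem_univ _, hPz⟩⟩
    · exact absurd hkz (not_lt.mpr (hk0 z))
  calc (univ.filter fun y => 0 < kernelAt P (t + 1) x y).card
      ≤ (A.biUnion fun z => univ.filter fun y => 0 < P z y).card := card_le_card hsub
    _ ≤ ∑ z ∈ A, (univ.filter fun y => 0 < P z y).card := card_biUnion_le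
    _ ≤ ∑ _z ∈ A, Δ := sum_le_sum fun z _ => hΔ z
    _ = Δ * A.card := by rw [sum_const, smul_eq_mul, mul_comm]

/-- `X_0^x = {x}`. [cite: LevinPeres2017, §7.1.1] -/
theorem accessible_zero (P : X → X → ℝ) (x : X) :
    (univ.filter fun y => 0 < kernelAt P 0 x y) = {x} := by
  ext y
  simp only [mem_filter, mem_univ, true_and, mem_singleton, kernelAt_zero_apply]
  constructor
  · intro h
    by_contra hne
    rw [if_neg hne] at h
    exact lt_irrefl _ h
  · intro h
    rw [if_pos h]
    exact one_pos

/-- **`|X_t^x| ≤ Δᵗ`**: the number of states accessible from `x` in exactly `t` steps is at most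
`Δᵗ` when every out-degree is at most `Δ`. [cite: LevinPeres2017, §7.1.1 ("observe that
`|X_t^x| ≤ Δᵗ`")] -/
theorem card_accessible_le_pow (hP : IsRowStochastic P) {Δ : ℕ}
    (hΔ : ∀ z, (univ.filter fun y => 0 < P z y).card ≤ Δ) (x : X) :
    ∀ t : ℕ, (univ.filter fun y => 0 < kernelAt P t x y).card ≤ Δ ^ t
  | 0 => by rw [accessible_zero, card_singleton, pow_zero]
  | t + 1 => (card_accessible_succ_le hP hΔ t x).trans <| by
      rw [pow_succ']
      exact Nat.mul_le_mul_left _ (card_accessible_le_pow hP hΔ x t)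

/-! ## `‖Pᵗ(x,·) − π‖_TV ≥ 1 − Δᵗ/|X|` for the uniform `π`, and eq. (7.2) -/

variable {π : X → ℝ}

/-- `Pᵗ(x, X_t^x) = 1`: all the mass of `Pᵗ(x,·)` sits on the accessible set.
[cite: LevinPeres2017, §7.1.1 (the display before eq. (7.2))] -/
theorem sum_accessible_kernelAt (hP : IsRowStochastic P) (t : ℕ) (x : X) :
    ∑ y ∈ univ.filter (fun y => 0 < kernelAt P t x y), kernelAt P t x y = 1 := by
  rw [sum_filter_of_ne fun y _ hne => lt_of_le_of_ne ((kernelAt_isRowStochastic hP t).1 x y)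
    (Ne.symm hne)]
  exact sum_kernelAt hP t x

/-- **`‖Pᵗ(x,·) − π‖_TV ≥ Pᵗ(x, X_t^x) − π(X_t^x) ≥ 1 − Δᵗ/|X|`** when `π` is uniform on `X` and
every out-degree is at most `Δ`. [cite: LevinPeres2017, §7.1.1 (the display before eq. (7.2))] -/
theorem LevinPeres2017_sec_7_1_1_tvDist (hP : IsRowStochastic P)
    (hπu : ∀ y, π y = (Fintype.card X : ℝ)⁻¹) {Δ : ℕ}
    (hΔ : ∀ z, (univ.filter fun y => 0 < P z y).card ≤ Δ) (t : ℕ) (x : X) :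
    1 - (Δ : ℝ) ^ t / Fintype.card X ≤ tvDist (kernelAt P t x) π := by
  have hX : (0 : ℝ) < Fintype.card X := by
    have : 0 < Fintype.card X := Fintype.card_pos_iff.mpr ⟨x⟩
    exact_mod_cast this
  set A := univ.filter fun y => 0 < kernelAt P t x y with hA
  have hmass : ∑ y, kernelAt P t x y = ∑ y, π y := by
    rw [sum_kernelAt hP t x]
    simp only [hπu, sum_const, card_univ, nsmul_eq_mul]
    rw [mul_inv_cancel₀ hX.ne']
  have h1 : ∑ y ∈ A, kernelAt P t x y = 1 := sum_accessible_kernelAt hP t x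
  have h2 : ∑ y ∈ A, π y = (A.card : ℝ) / Fintype.card X := by
    simp only [hπu, sum_const, nsmul_eq_mul]
    rw [div_eq_mul_inv]
  have h3 : (A.card : ℝ) ≤ (Δ : ℝ) ^ t := by
    exact_mod_cast card_accessible_le_pow hP hΔ x t
  calc 1 - (Δ : ℝ) ^ t / Fintype.card X ≤ 1 - (A.card : ℝ) / Fintype.card X := by
        gcongr
    _ = ∑ y ∈ A, kernelAt P t x y - ∑ y ∈ A, π y := by rw [h1, h2]
    _ ≤ tvDist (kernelAt P t x) π := sub_sum_le_tvDist hmass A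

/-- "If `Δᵗ < (1 − ε)|X|`, then … `‖Pᵗ(x,·) − π‖_TV ≥ 1 − Δᵗ/|X| > ε`" — for the uniform `π` and every
starting state `x`; in particular `d(t) > ε`. [cite: LevinPeres2017, §7.1.1 (the display before
eq. (7.2))] -/
theorem LevinPeres2017_eq_7_2_lt (hP : IsRowStochastic P) (hπu : ∀ y, π y = (Fintype.card X : ℝ)⁻¹)
    {Δ : ℕ} (hΔ : ∀ z, (univ.filter fun y => 0 < P z y).card ≤ Δ) {ε : ℝ} {t : ℕ}
    (h : (Δ : ℝ) ^ t < (1 - ε) * Fintype.card X) (x : X) :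
    ε < worstTvDist P π t := by
  have hX : (0 : ℝ) < Fintype.card X := by
    have : 0 < Fintype.card X := Fintype.card_pos_iff.mpr ⟨x⟩
    exact_mod_cast this
  have hlt : ε < 1 - (Δ : ℝ) ^ t / Fintype.card X := by
    rw [lt_sub_comm, div_lt_iff₀ hX]
    exact h
  calc ε < 1 - (Δ : ℝ) ^ t / Fintype.card X := hlt
    _ ≤ tvDist (kernelAt P t x) π := LevinPeres2017_sec_7_1_1_tvDist hP hπu hΔ t x
    _ ≤ worstTvDist P π t := tvDist_single_le_worstTvDist P π t x

/-- **`Δ^{t_mix(ε)} ≥ (1 − ε)|X|`** for the uniform `π` (the contrapositive of the previous bound at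
`t = t_mix(ε)`, where `d ≤ ε`; assumes some `t₀` has `d(t₀) ≤ ε`). [cite: LevinPeres2017, §7.1.1
("This implies that …" eq. (7.2))] -/
theorem LevinPeres2017_eq_7_2_pow (hP : IsRowStochastic P) (hπu : ∀ y, π y = (Fintype.card X : ℝ)⁻¹)
    {Δ : ℕ} (hΔ : ∀ z, (univ.filter fun y => 0 < P z y).card ≤ Δ) {ε : ℝ} {t₀ : ℕ}
    (ht₀ : worstTvDist P π t₀ ≤ ε) :
    (1 - ε) * Fintype.card X ≤ (Δ : ℝ) ^ mixingTime P π ε := by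
  by_contra hlt
  rw [not_le] at hlt
  rcases isEmpty_or_nonempty X with hX | hX
  · have h0 : (Fintype.card X : ℝ) = 0 := by exact_mod_cast Fintype.card_eq_zero
    rw [h0, mul_zero] at hlt
    exact absurd hlt (not_lt.mpr (pow_nonneg (Nat.cast_nonneg Δ) _))
  · obtain ⟨x⟩ := hX
    exact absurd (worstTvDist_mixingTime_le P π ht₀)
      (not_le.mpr (LevinPeres2017_eq_7_2_lt hP hπu hΔ hlt x))

/-- **Eq. (7.2), the counting bound** (Levin–Peres–Wilmer §7.1.1): let `P` be a row-stochastic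
kernel on the finite nonempty `X` whose stationary distribution `π` is UNIFORM, let
`d_out(x) = |{y : P(x,y) > 0}| ≤ Δ` for all `x` (eq. (7.1): `Δ = max_x d_out(x)`), and let `ε < 1`
with `d(t₀) ≤ ε` for some `t₀`.  Then **`t_mix(ε) ≥ log(|X|(1 − ε)) / log Δ`**.  (If `Δ = 1` the
right side is `·/0 = 0` in Lean and the bound is empty, as in print.)
[cite: LevinPeres2017, §7.1.1 eq. (7.2)] -/
theorem LevinPeres2017_eq_7_2 [Nonempty X] (hP : IsRowStochastic P)
    (hπu : ∀ y, π y = (Fintype.card X : ℝ)⁻¹) {Δ : ℕ}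
    (hΔ : ∀ z, (univ.filter fun y => 0 < P z y).card ≤ Δ) {ε : ℝ} (hε : ε < 1) {t₀ : ℕ}
    (ht₀ : worstTvDist P π t₀ ≤ ε) :
    Real.log (Fintype.card X * (1 - ε)) / Real.log Δ ≤ (mixingTime P π ε : ℝ) := by
  have hX : (0 : ℝ) < Fintype.card X := by exact_mod_cast Fintype.card_pos
  have hpow := LevinPeres2017_eq_7_2_pow hP hπu hΔ ht₀
  have hΔ1 : 1 ≤ Δ := (one_le_outDegree hP (Classical.arbitrary X)).trans (hΔ _)
  rcases hΔ1.eq_or_lt with h1 | h2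
  · -- `Δ = 1`: `log Δ = 0`, the right side of (7.2) is `0` by convention
    rw [← h1, Nat.cast_one, Real.log_one, div_zero]
    exact Nat.cast_nonneg _
  · have hΔpos : (0 : ℝ) < Real.log Δ := Real.log_pos (by exact_mod_cast h2)
    rw [div_le_iff₀ hΔpos, ← Real.log_pow, mul_comm]
    exact Real.log_le_log (by nlinarith) hpow

end Counting

end Literature.Probability.MarkovChains
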